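import Summits.Ventures.CertifiedManyBodySolver.Upper.IntervalReaderObservableRows

/-!
# Ventures/CertifiedManyBodySolver — Upper/IntervalReaderSourcedObsClaimNode.lean: bytes ⇒ THE NINE- AND
# ELEVEN-CONJUNCT W5 CLAIM NODES (merge layout)
(part 37 of the Theorem-H1′ package; parts 1–36: `IntervalReaderSchur` … `IntervalReaderObservableRows`)

HONEST FRAMING: first certified bounds; not a superconductivity verdict; every number certified (two readers)
or labelled float.  A sourced-Hamiltonian upper with observable windows is a list of certified variational
statements about ONE finite-box vector; it is never a sign of order and never an order-parameter word
(LADDER v1.17 (i)).  This file composes already-landed theorems; it certifies no number and moves no row.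

THE NODES OF RECORD WITH OBSERVABLE ROWS (ref-2c g29 precision P14).  The W5 certificates' supplementary nodes
`Certificates/…_sourced_…_twoFieldDiagHop.lean` (NINE conjuncts: the seven of part 32 and the `K₂` window
`k2lo·ab ≤ Re⟨ψ, hamiltonian (rectBoxDiagGraph a b) 1 0 ψ⟩ ≤ k2hi·ab`) and `…_twoFieldDoccDiagHop.lean` (ELEVEN:
the `docc` window `dlo·ab ≤ Re⟨ψ, (Σ_x n_{x↑}n_{x↓}) ψ⟩ ≤ dhi·ab` inserted before the `K₂` rows, x2dk order) are
about the SAME witness as the five-conjunct node.  Part 31 derives that witness's sector (V1), positivity (V3),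
energy sentence and density window from the bytes of the `H̃`-, `Ñ`- and `Nrm`-sweeps; the remaining rows are
Rayleigh rows of transformed observables `S′ᴴ X S′` of the SAME vector `ψ̃ = toSpinVec⁻¹Ψ`, each discharged
from ITS sweep's bytes by a window theorem already in the tree:

* zero-field energy `X = A_C(μ,0)`: part 32's `quadraticWindow_of_reader` at the `h = 0` tables followed by
  `gaugedShiba'_conjTranspose_conj_dWaveSourceOpenBox a b U μ 0` (as inside `producersSourcedBoxTwoFieldNode_of_reader`);
* double occupancy `X = Σ n↑n↓`: part 36's `doccWindow_of_reader`;
* hopping word `X = hamiltonian (rectBoxDiagGraph a b) 1 0`: part 36's `hoppingWindow_of_reader`.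

Hence, with those rows as hypotheses ON `ψ̃` (so that each is supplied by the matching window theorem at the read
point, and the zero-field row by whichever derivation the record carries):

* **`producersSourcedBoxDiagHopNode_of_reader`** — part 31's hypotheses + the four `A_C(μ,0)` / `K₂` rows ⟹ the
  NINE-conjunct node (ird-5's `sourcedBoxThreeRowNode_of_gaugedShibaWitness'`), parity `Ñ + ab`;
* **`producersSourcedBoxDoccDiagHopNode_of_reader`** — the same + the two `docc` rows ⟹ the ELEVEN-conjunct node
  (part 36's `sourcedBoxFourRowNode_of_gaugedShibaWitness'`) — the body of
  `cert_sgf_openbox32x4_U8_mu7o4_k3o7_j264564_twoFieldDoccDiagHop` up to `HasParity.mono`.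

Inputs outside the bytes, unchanged: the contractions (kit), the machine premises (A1)/(A2), the code tables =
`quadAutomaton` by value, the by-value tests, the F-V2 labels and `n_lo > 0`.  Part 38 is the embed layout.
-/

noncomputable section

open Matrix Finset WithLp
open scoped BigOperators ComplexOrder Matrix.Norms.L2Operator

namespace Summit.Ventures.CertifiedManyBodySolver.Upper.IntervalReader

open Literature.MathematicalPhysics.QuantumLattice
open Literature.MathematicalPhysics.QuantumLattice.JordanWigner
open Literature.MathematicalPhysics.QuantumLattice.TwoCluster (HasParity)

section ObsNodes

variable {a b D : ℕ}

/-- **THE NINE-CONJUNCT W5 NODE (`…_twoFieldDiagHop`), PRODUCERS' FRAME, merge layout** (real sign gauge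
`g i = ±1`).  Hypotheses: part 31's `producersSourcedBoxNode_of_reader` (bytes of the `H̃`-, `Ñ`-, `Nrm`-sweeps,
the ACCEPT test vs `e·ab`, the density window tests, `n_lo > 0`, F-V2 labels) + the zero-field energy rows and the
`K₂` rows of the SAME vector `ψ̃ = toSpinVec⁻¹Ψ` in the frame `S′ = W·orbitalPhase g` (each supplied from its own
sweep's bytes: part 32's `quadraticWindow_of_reader` / part 36's `hoppingWindow_of_reader`).  Conclusion: the nine
conjuncts of ird-5's `sourcedBoxThreeRowNode_of_gaugedShibaWitness'`, parity `Ñ + ab`. -/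
theorem producersSourcedBoxDiagHopNode_of_reader (U μ h : ℝ) (eQ nlo nhi e0lo e0hi k2lo k2hi : ℚ)
    {g : Orb (Fin a ×ₗ Fin b) → ℂ}
    (hg : ∀ i, g i = 1 ∨ g i = -1) (e : Fin (a * b) ≃ (Fin a ×ₗ Fin b))
    (he : ∀ i j, e i < e j ↔ i < j) (A : Fin (a * b) → MPSTensor 4 D) (l r : Fin D → ℂ)
    (κ : Fin (a * b) → ℝ) (hκ0 : ∀ k, 0 ≤ κ k)
    (hκ : ∀ k (z : EuclideanSpace ℂ (Fin D)), ∑ s, ‖toLp 2 (A k s *ᵥ ofLp z)‖ ^ 2 ≤ κ k * ‖z‖ ^ 2)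
    -- the `H̃`-sweep (part 22, producers' frame)
    (Mo : Fin (a * b) → QState (a * b) → QState (a * b) → ℝ) (hM0 : ∀ k b' c, 0 ≤ Mo k b' c)
    (hMrow : ∀ k b' c s, ∑ s', ‖quadAutomaton (dGammaHop (orbPullback e
      (Matrix.of fun i j => star (g i) * g j * w5Nambu a b μ h i j))) (fun _ _ _ _ => 0)
      (quadOnSite (Matrix.of fun i j => star (g i) * g j * w5Nambu a b μ h i j) U μ e) k b' c s s'‖ ≤ Mo k b' c)
    (hMcol : ∀ k b' c s', ∑ s, ‖quadAutomaton (dGammaHop (orbPullback e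
      (Matrix.of fun i j => star (g i) * g j * w5Nambu a b μ h i j))) (fun _ _ _ _ => 0)
      (quadOnSite (Matrix.of fun i j => star (g i) * g j * w5Nambu a b μ h i j) U μ e) k b' c s s'‖ ≤ Mo k b' c)
    (YH : Fin (a * b + 1) → QState (a * b) → Matrix (Fin D) (Fin D) ℂ) (ρH : Fin (a * b) → QState (a * b) → ℝ)
    (hρH : ∀ (k : Fin (a * b)) (c : QState (a * b)),
      ‖YH k.succ c - ∑ b', transferOp (A k) (quadAutomaton (dGammaHop (orbPullback e
        (Matrix.of fun i j => star (g i) * g j * w5Nambu a b μ h i j))) (fun _ _ _ _ => 0)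
        (quadOnSite (Matrix.of fun i j => star (g i) * g j * w5Nambu a b μ h i j) U μ e) k b' c)
        (YH k.castSucc b')‖ ≤ ρH k c)
    (radH : Fin (a * b + 1) → QState (a * b) → ℝ)
    (hrH0 : ∀ b', ‖YH 0 b' -
      (Pi.single QState.start (vecMulVec (star l) l) : QState (a * b) → Matrix (Fin D) (Fin D) ℂ) b'‖ ≤ radH 0 b')
    (hrH : ∀ (k : Fin (a * b)) (c : QState (a * b)),
      ∑ b', Mo k b' c * κ k * radH k.castSucc b' + ρH k c ≤ radH k.succ c)
    -- the `Ñ`-sweep (part 23)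
    (Mn : Fin (a * b) → QState (a * b) → QState (a * b) → ℝ) (hMn0 : ∀ k b' c, 0 ≤ Mn k b' c)
    (hMnrow : ∀ k b' c s, ∑ s', ‖quadAutomaton (fun _ _ _ _ => 0) (fun _ _ _ _ => 0) (numberOnSite a b) k b' c s s'‖ ≤
      Mn k b' c)
    (hMncol : ∀ k b' c s', ∑ s, ‖quadAutomaton (fun _ _ _ _ => 0) (fun _ _ _ _ => 0) (numberOnSite a b) k b' c s s'‖ ≤
      Mn k b' c)
    (YD : Fin (a * b + 1) → QState (a * b) → Matrix (Fin D) (Fin D) ℂ) (ρD : Fin (a * b) → QState (a * b) → ℝ)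
    (hρD : ∀ (k : Fin (a * b)) (c : QState (a * b)),
      ‖YD k.succ c - ∑ b', transferOp (A k) (quadAutomaton (fun _ _ _ _ => 0) (fun _ _ _ _ => 0) (numberOnSite a b)
        k b' c) (YD k.castSucc b')‖ ≤ ρD k c)
    (radD : Fin (a * b + 1) → QState (a * b) → ℝ)
    (hrD0 : ∀ b', ‖YD 0 b' -
      (Pi.single QState.start (vecMulVec (star l) l) : QState (a * b) → Matrix (Fin D) (Fin D) ℂ) b'‖ ≤ radD 0 b')
    (hrD : ∀ (k : Fin (a * b)) (c : QState (a * b)),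
      ∑ b', Mn k b' c * κ k * radD k.castSucc b' + ρD k c ≤ radD k.succ c)
    -- the `Nrm`-sweep (shared)
    (YN : Fin (a * b + 1) → Matrix (Fin D) (Fin D) ℂ) (ρN : Fin (a * b) → ℝ)
    (hρN : ∀ k : Fin (a * b), ‖YN k.succ - transferOp (A k) 1 (YN k.castSucc)‖ ≤ ρN k)
    (radN : Fin (a * b + 1) → ℝ) (hrN0 : ‖YN 0 - vecMulVec (star l) l‖ ≤ radN 0)
    (hrN : ∀ k : Fin (a * b), 1 * κ k * radN k.castSucc + ρN k ≤ radN k.succ)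
    -- the by-value ACCEPT test of the energy row against `E = e·ab`
    (hElo : (star r ⬝ᵥ (YH (Fin.last (a * b)) QState.fin *ᵥ r)).re +
        (∑ i, ‖r i‖) * (∑ i, ‖r i‖) * radH (Fin.last (a * b)) QState.fin ≤
      ((eQ : ℝ) * ((a : ℝ) * b)) * ((star r ⬝ᵥ (YN (Fin.last (a * b)) *ᵥ r)).re -
        (∑ i, ‖r i‖) * (∑ i, ‖r i‖) * radN (Fin.last (a * b))))
    (hEhi : (star r ⬝ᵥ (YH (Fin.last (a * b)) QState.fin *ᵥ r)).re +
        (∑ i, ‖r i‖) * (∑ i, ‖r i‖) * radH (Fin.last (a * b)) QState.fin ≤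
      ((eQ : ℝ) * ((a : ℝ) * b)) * ((star r ⬝ᵥ (YN (Fin.last (a * b)) *ᵥ r)).re +
        (∑ i, ‖r i‖) * (∑ i, ‖r i‖) * radN (Fin.last (a * b))))
    -- the four by-value window tests of the density rows against `n_lo·ab`, `n_hi·ab`
    (hnlo1 : ((nlo : ℝ) * ((a : ℝ) * b)) * ((star r ⬝ᵥ (YN (Fin.last (a * b)) *ᵥ r)).re -
        (∑ i, ‖r i‖) * (∑ i, ‖r i‖) * radN (Fin.last (a * b))) ≤
      (star r ⬝ᵥ (YD (Fin.last (a * b)) QState.fin *ᵥ r)).re -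
        (∑ i, ‖r i‖) * (∑ i, ‖r i‖) * radD (Fin.last (a * b)) QState.fin)
    (hnlo2 : ((nlo : ℝ) * ((a : ℝ) * b)) * ((star r ⬝ᵥ (YN (Fin.last (a * b)) *ᵥ r)).re +
        (∑ i, ‖r i‖) * (∑ i, ‖r i‖) * radN (Fin.last (a * b))) ≤
      (star r ⬝ᵥ (YD (Fin.last (a * b)) QState.fin *ᵥ r)).re -
        (∑ i, ‖r i‖) * (∑ i, ‖r i‖) * radD (Fin.last (a * b)) QState.fin)
    (hnhi1 : (star r ⬝ᵥ (YD (Fin.last (a * b)) QState.fin *ᵥ r)).re +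
        (∑ i, ‖r i‖) * (∑ i, ‖r i‖) * radD (Fin.last (a * b)) QState.fin ≤
      ((nhi : ℝ) * ((a : ℝ) * b)) * ((star r ⬝ᵥ (YN (Fin.last (a * b)) *ᵥ r)).re -
        (∑ i, ‖r i‖) * (∑ i, ‖r i‖) * radN (Fin.last (a * b))))
    (hnhi2 : (star r ⬝ᵥ (YD (Fin.last (a * b)) QState.fin *ᵥ r)).re +
        (∑ i, ‖r i‖) * (∑ i, ‖r i‖) * radD (Fin.last (a * b)) QState.fin ≤
      ((nhi : ℝ) * ((a : ℝ) * b)) * ((star r ⬝ᵥ (YN (Fin.last (a * b)) *ᵥ r)).re +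
        (∑ i, ‖r i‖) * (∑ i, ‖r i‖) * radN (Fin.last (a * b))))
    -- the code's assertion `n_lo > 0` (h1sweep.py l.398)
    (hn : (∑ i, ‖r i‖) * (∑ i, ‖r i‖) * radN (Fin.last (a * b)) < (star r ⬝ᵥ (YN (Fin.last (a * b)) *ᵥ r)).re)
    -- the certificate's F-V2 bond-charge labels (FORMAT-mpsgf1 §2 V1: transformed particle number `Ñ`)
    (Nt : ℕ) (c : Fin (a * b + 1) → Fin D → ℕ)
    (hcl : ∀ α, l α ≠ 0 → c 0 α = 0) (hcr : ∀ β, r β ≠ 0 → c (Fin.last (a * b)) β = Nt)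
    (hcA : ∀ (j : Fin (a * b)) (s : Fin 4) (α β : Fin D),
      A j s α β ≠ 0 → c j.succ β = c j.castSucc α + siteCharge s)
    -- the zero-field energy rows of `ψ̃` (part 32's `quadraticWindow_of_reader` at `h = 0`, or derived)
    (h0lo : ((e0lo : ℝ) * ((a : ℝ) * b)) *
        (star (toSpinVec.symm
            (fun k : TensorIndex (Fin a ×ₗ Fin b) 4 => mpsOpenVar (a * b) A l r (fun i => k (e i)))) ⬝ᵥ
          toSpinVec.symm
            (fun k : TensorIndex (Fin a ×ₗ Fin b) 4 => mpsOpenVar (a * b) A l r (fun i => k (e i)))).re ≤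
      (star (toSpinVec.symm
          (fun k : TensorIndex (Fin a ×ₗ Fin b) 4 => mpsOpenVar (a * b) A l r (fun i => k (e i)))) ⬝ᵥ
        (((partialParticleHole (spinDownOrbitals : Finset (Orb (Fin a ×ₗ Fin b))) * orbitalPhase g)ᴴ *
            dWaveSourceOpenBox a b U μ 0 *
            (partialParticleHole (spinDownOrbitals : Finset (Orb (Fin a ×ₗ Fin b))) * orbitalPhase g)) *ᵥ
          toSpinVec.symm
            (fun k : TensorIndex (Fin a ×ₗ Fin b) 4 => mpsOpenVar (a * b) A l r (fun i => k (e i))))).re)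
    (h0hi : (star (toSpinVec.symm
          (fun k : TensorIndex (Fin a ×ₗ Fin b) 4 => mpsOpenVar (a * b) A l r (fun i => k (e i)))) ⬝ᵥ
        (((partialParticleHole (spinDownOrbitals : Finset (Orb (Fin a ×ₗ Fin b))) * orbitalPhase g)ᴴ *
            dWaveSourceOpenBox a b U μ 0 *
            (partialParticleHole (spinDownOrbitals : Finset (Orb (Fin a ×ₗ Fin b))) * orbitalPhase g)) *ᵥ
          toSpinVec.symm
            (fun k : TensorIndex (Fin a ×ₗ Fin b) 4 => mpsOpenVar (a * b) A l r (fun i => k (e i))))).re ≤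
      ((e0hi : ℝ) * ((a : ℝ) * b)) *
        (star (toSpinVec.symm
            (fun k : TensorIndex (Fin a ×ₗ Fin b) 4 => mpsOpenVar (a * b) A l r (fun i => k (e i)))) ⬝ᵥ
          toSpinVec.symm
            (fun k : TensorIndex (Fin a ×ₗ Fin b) 4 => mpsOpenVar (a * b) A l r (fun i => k (e i)))).re)
    -- the `K₂` rows of `ψ̃` (part 36's `hoppingWindow_of_reader` at `G = rectBoxDiagGraph a b`, `t = 1`)
    (hklo : ((k2lo : ℝ) * ((a : ℝ) * b)) *
        (star (toSpinVec.symm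
            (fun k : TensorIndex (Fin a ×ₗ Fin b) 4 => mpsOpenVar (a * b) A l r (fun i => k (e i)))) ⬝ᵥ
          toSpinVec.symm
            (fun k : TensorIndex (Fin a ×ₗ Fin b) 4 => mpsOpenVar (a * b) A l r (fun i => k (e i)))).re ≤
      (star (toSpinVec.symm
          (fun k : TensorIndex (Fin a ×ₗ Fin b) 4 => mpsOpenVar (a * b) A l r (fun i => k (e i)))) ⬝ᵥ
        (((partialParticleHole (spinDownOrbitals : Finset (Orb (Fin a ×ₗ Fin b))) * orbitalPhase g)ᴴ *
            hamiltonian (rectBoxDiagGraph a b) 1 0 *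
            (partialParticleHole (spinDownOrbitals : Finset (Orb (Fin a ×ₗ Fin b))) * orbitalPhase g)) *ᵥ
          toSpinVec.symm
            (fun k : TensorIndex (Fin a ×ₗ Fin b) 4 => mpsOpenVar (a * b) A l r (fun i => k (e i))))).re)
    (hkhi : (star (toSpinVec.symm
          (fun k : TensorIndex (Fin a ×ₗ Fin b) 4 => mpsOpenVar (a * b) A l r (fun i => k (e i)))) ⬝ᵥ
        (((partialParticleHole (spinDownOrbitals : Finset (Orb (Fin a ×ₗ Fin b))) * orbitalPhase g)ᴴ *
            hamiltonian (rectBoxDiagGraph a b) 1 0 *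
            (partialParticleHole (spinDownOrbitals : Finset (Orb (Fin a ×ₗ Fin b))) * orbitalPhase g)) *ᵥ
          toSpinVec.symm
            (fun k : TensorIndex (Fin a ×ₗ Fin b) 4 => mpsOpenVar (a * b) A l r (fun i => k (e i))))).re ≤
      ((k2hi : ℝ) * ((a : ℝ) * b)) *
        (star (toSpinVec.symm
            (fun k : TensorIndex (Fin a ×ₗ Fin b) 4 => mpsOpenVar (a * b) A l r (fun i => k (e i)))) ⬝ᵥ
          toSpinVec.symm
            (fun k : TensorIndex (Fin a ×ₗ Fin b) 4 => mpsOpenVar (a * b) A l r (fun i => k (e i)))).re) :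
    ∃ ψ : Fock (Orb (Fin a ×ₗ Fin b)), HasParity (Nt + a * b) ψ ∧ star ψ ⬝ᵥ ψ = 1 ∧
      (star ψ ⬝ᵥ (dWaveSourceOpenBox a b U μ h *ᵥ ψ)).re ≤ ((eQ : ℚ) : ℝ) * ((a : ℝ) * b) ∧
      ((nlo : ℚ) : ℝ) * ((a : ℝ) * b) ≤ (star ψ ⬝ᵥ (totalNumber *ᵥ ψ)).re ∧
      (star ψ ⬝ᵥ (totalNumber *ᵥ ψ)).re ≤ ((nhi : ℚ) : ℝ) * ((a : ℝ) * b) ∧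
      ((e0lo : ℚ) : ℝ) * ((a : ℝ) * b) ≤ (star ψ ⬝ᵥ (dWaveSourceOpenBox a b U μ 0 *ᵥ ψ)).re ∧
      (star ψ ⬝ᵥ (dWaveSourceOpenBox a b U μ 0 *ᵥ ψ)).re ≤ ((e0hi : ℚ) : ℝ) * ((a : ℝ) * b) ∧
      ((k2lo : ℚ) : ℝ) * ((a : ℝ) * b) ≤ (star ψ ⬝ᵥ (hamiltonian (rectBoxDiagGraph a b) 1 0 *ᵥ ψ)).re ∧
      (star ψ ⬝ᵥ (hamiltonian (rectBoxDiagGraph a b) 1 0 *ᵥ ψ)).re ≤ ((k2hi : ℚ) : ℝ) * ((a : ℝ) * b) := by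
  have hg' : ∀ i, ‖g i‖ = 1 := fun i => by rcases hg i with h1 | h1 <;> simp [h1]
  -- the energy row (part 22, producers' frame)
  have hE := producersSourcedBox_sentence_of_reader U μ h hg e he A l r κ hκ0 hκ Mo hM0 hMrow hMcol YH ρH hρH radH
    hrH0 hrH YN ρN hρN radN hrN0 hrN ((eQ : ℝ) * ((a : ℝ) * b)) hElo hEhi
  -- the density window (part 23), moved into the producers' frame
  have hDW := densityWindow_of_reader e A l r κ hκ0 hκ Mn hMn0 hMnrow hMncol YD ρD hρD radD hrD0 hrD YN ρN hρN radN
    hrN0 hrN ((nlo : ℝ) * ((a : ℝ) * b)) ((nhi : ℝ) * ((a : ℝ) * b)) hnlo1 hnlo2 hnhi1 hnhi2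
  rw [← gaugedShiba'_conjTranspose_conj_totalNumber hg'] at hDW
  -- V1 and V3 (part 31)
  have hN := transformedWitness_sector_of_reader e A l r Nt c hcl hcr hcA
  have hpos := transformedWitness_pos_of_reader e A l r κ hκ0 hκ YN ρN hρN radN hrN0 hrN hn
  exact sourcedBoxThreeRowNode_of_gaugedShibaWitness' a b U μ h eQ nlo nhi e0lo e0hi k2lo k2hi hg' _ hN hpos hE
    hDW.1 hDW.2 h0lo h0hi hklo hkhi

/-- **THE ELEVEN-CONJUNCT W5 NODE (`…_twoFieldDoccDiagHop`), PRODUCERS' FRAME, merge layout.**  As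
`producersSourcedBoxDiagHopNode_of_reader` plus the `docc` rows of `ψ̃` (part 36's `doccWindow_of_reader`), x2dk
order.  Conclusion: the eleven conjuncts of part 36's `sourcedBoxFourRowNode_of_gaugedShibaWitness'`, parity
`Ñ + ab` — the body of `cert_sgf_openbox32x4_U8_mu7o4_k3o7_j264564_twoFieldDoccDiagHop` up to `HasParity.mono`. -/
theorem producersSourcedBoxDoccDiagHopNode_of_reader (U μ h : ℝ) (eQ nlo nhi e0lo e0hi dlo dhi k2lo k2hi : ℚ)
    {g : Orb (Fin a ×ₗ Fin b) → ℂ}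
    (hg : ∀ i, g i = 1 ∨ g i = -1) (e : Fin (a * b) ≃ (Fin a ×ₗ Fin b))
    (he : ∀ i j, e i < e j ↔ i < j) (A : Fin (a * b) → MPSTensor 4 D) (l r : Fin D → ℂ)
    (κ : Fin (a * b) → ℝ) (hκ0 : ∀ k, 0 ≤ κ k)
    (hκ : ∀ k (z : EuclideanSpace ℂ (Fin D)), ∑ s, ‖toLp 2 (A k s *ᵥ ofLp z)‖ ^ 2 ≤ κ k * ‖z‖ ^ 2)
    -- the `H̃`-sweep (part 22, producers' frame)
    (Mo : Fin (a * b) → QState (a * b) → QState (a * b) → ℝ) (hM0 : ∀ k b' c, 0 ≤ Mo k b' c)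
    (hMrow : ∀ k b' c s, ∑ s', ‖quadAutomaton (dGammaHop (orbPullback e
      (Matrix.of fun i j => star (g i) * g j * w5Nambu a b μ h i j))) (fun _ _ _ _ => 0)
      (quadOnSite (Matrix.of fun i j => star (g i) * g j * w5Nambu a b μ h i j) U μ e) k b' c s s'‖ ≤ Mo k b' c)
    (hMcol : ∀ k b' c s', ∑ s, ‖quadAutomaton (dGammaHop (orbPullback e
      (Matrix.of fun i j => star (g i) * g j * w5Nambu a b μ h i j))) (fun _ _ _ _ => 0)
      (quadOnSite (Matrix.of fun i j => star (g i) * g j * w5Nambu a b μ h i j) U μ e) k b' c s s'‖ ≤ Mo k b' c)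
    (YH : Fin (a * b + 1) → QState (a * b) → Matrix (Fin D) (Fin D) ℂ) (ρH : Fin (a * b) → QState (a * b) → ℝ)
    (hρH : ∀ (k : Fin (a * b)) (c : QState (a * b)),
      ‖YH k.succ c - ∑ b', transferOp (A k) (quadAutomaton (dGammaHop (orbPullback e
        (Matrix.of fun i j => star (g i) * g j * w5Nambu a b μ h i j))) (fun _ _ _ _ => 0)
        (quadOnSite (Matrix.of fun i j => star (g i) * g j * w5Nambu a b μ h i j) U μ e) k b' c)
        (YH k.castSucc b')‖ ≤ ρH k c)
    (radH : Fin (a * b + 1) → QState (a * b) → ℝ)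
    (hrH0 : ∀ b', ‖YH 0 b' -
      (Pi.single QState.start (vecMulVec (star l) l) : QState (a * b) → Matrix (Fin D) (Fin D) ℂ) b'‖ ≤ radH 0 b')
    (hrH : ∀ (k : Fin (a * b)) (c : QState (a * b)),
      ∑ b', Mo k b' c * κ k * radH k.castSucc b' + ρH k c ≤ radH k.succ c)
    -- the `Ñ`-sweep (part 23)
    (Mn : Fin (a * b) → QState (a * b) → QState (a * b) → ℝ) (hMn0 : ∀ k b' c, 0 ≤ Mn k b' c)
    (hMnrow : ∀ k b' c s, ∑ s', ‖quadAutomaton (fun _ _ _ _ => 0) (fun _ _ _ _ => 0) (numberOnSite a b) k b' c s s'‖ ≤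
      Mn k b' c)
    (hMncol : ∀ k b' c s', ∑ s, ‖quadAutomaton (fun _ _ _ _ => 0) (fun _ _ _ _ => 0) (numberOnSite a b) k b' c s s'‖ ≤
      Mn k b' c)
    (YD : Fin (a * b + 1) → QState (a * b) → Matrix (Fin D) (Fin D) ℂ) (ρD : Fin (a * b) → QState (a * b) → ℝ)
    (hρD : ∀ (k : Fin (a * b)) (c : QState (a * b)),
      ‖YD k.succ c - ∑ b', transferOp (A k) (quadAutomaton (fun _ _ _ _ => 0) (fun _ _ _ _ => 0) (numberOnSite a b)
        k b' c) (YD k.castSucc b')‖ ≤ ρD k c)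
    (radD : Fin (a * b + 1) → QState (a * b) → ℝ)
    (hrD0 : ∀ b', ‖YD 0 b' -
      (Pi.single QState.start (vecMulVec (star l) l) : QState (a * b) → Matrix (Fin D) (Fin D) ℂ) b'‖ ≤ radD 0 b')
    (hrD : ∀ (k : Fin (a * b)) (c : QState (a * b)),
      ∑ b', Mn k b' c * κ k * radD k.castSucc b' + ρD k c ≤ radD k.succ c)
    -- the `Nrm`-sweep (shared)
    (YN : Fin (a * b + 1) → Matrix (Fin D) (Fin D) ℂ) (ρN : Fin (a * b) → ℝ)
    (hρN : ∀ k : Fin (a * b), ‖YN k.succ - transferOp (A k) 1 (YN k.castSucc)‖ ≤ ρN k)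
    (radN : Fin (a * b + 1) → ℝ) (hrN0 : ‖YN 0 - vecMulVec (star l) l‖ ≤ radN 0)
    (hrN : ∀ k : Fin (a * b), 1 * κ k * radN k.castSucc + ρN k ≤ radN k.succ)
    -- the by-value ACCEPT test of the energy row against `E = e·ab`
    (hElo : (star r ⬝ᵥ (YH (Fin.last (a * b)) QState.fin *ᵥ r)).re +
        (∑ i, ‖r i‖) * (∑ i, ‖r i‖) * radH (Fin.last (a * b)) QState.fin ≤
      ((eQ : ℝ) * ((a : ℝ) * b)) * ((star r ⬝ᵥ (YN (Fin.last (a * b)) *ᵥ r)).re -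
        (∑ i, ‖r i‖) * (∑ i, ‖r i‖) * radN (Fin.last (a * b))))
    (hEhi : (star r ⬝ᵥ (YH (Fin.last (a * b)) QState.fin *ᵥ r)).re +
        (∑ i, ‖r i‖) * (∑ i, ‖r i‖) * radH (Fin.last (a * b)) QState.fin ≤
      ((eQ : ℝ) * ((a : ℝ) * b)) * ((star r ⬝ᵥ (YN (Fin.last (a * b)) *ᵥ r)).re +
        (∑ i, ‖r i‖) * (∑ i, ‖r i‖) * radN (Fin.last (a * b))))
    -- the four by-value window tests of the density rows against `n_lo·ab`, `n_hi·ab`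
    (hnlo1 : ((nlo : ℝ) * ((a : ℝ) * b)) * ((star r ⬝ᵥ (YN (Fin.last (a * b)) *ᵥ r)).re -
        (∑ i, ‖r i‖) * (∑ i, ‖r i‖) * radN (Fin.last (a * b))) ≤
      (star r ⬝ᵥ (YD (Fin.last (a * b)) QState.fin *ᵥ r)).re -
        (∑ i, ‖r i‖) * (∑ i, ‖r i‖) * radD (Fin.last (a * b)) QState.fin)
    (hnlo2 : ((nlo : ℝ) * ((a : ℝ) * b)) * ((star r ⬝ᵥ (YN (Fin.last (a * b)) *ᵥ r)).re +
        (∑ i, ‖r i‖) * (∑ i, ‖r i‖) * radN (Fin.last (a * b))) ≤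
      (star r ⬝ᵥ (YD (Fin.last (a * b)) QState.fin *ᵥ r)).re -
        (∑ i, ‖r i‖) * (∑ i, ‖r i‖) * radD (Fin.last (a * b)) QState.fin)
    (hnhi1 : (star r ⬝ᵥ (YD (Fin.last (a * b)) QState.fin *ᵥ r)).re +
        (∑ i, ‖r i‖) * (∑ i, ‖r i‖) * radD (Fin.last (a * b)) QState.fin ≤
      ((nhi : ℝ) * ((a : ℝ) * b)) * ((star r ⬝ᵥ (YN (Fin.last (a * b)) *ᵥ r)).re -
        (∑ i, ‖r i‖) * (∑ i, ‖r i‖) * radN (Fin.last (a * b))))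
    (hnhi2 : (star r ⬝ᵥ (YD (Fin.last (a * b)) QState.fin *ᵥ r)).re +
        (∑ i, ‖r i‖) * (∑ i, ‖r i‖) * radD (Fin.last (a * b)) QState.fin ≤
      ((nhi : ℝ) * ((a : ℝ) * b)) * ((star r ⬝ᵥ (YN (Fin.last (a * b)) *ᵥ r)).re +
        (∑ i, ‖r i‖) * (∑ i, ‖r i‖) * radN (Fin.last (a * b))))
    -- the code's assertion `n_lo > 0` (h1sweep.py l.398)
    (hn : (∑ i, ‖r i‖) * (∑ i, ‖r i‖) * radN (Fin.last (a * b)) < (star r ⬝ᵥ (YN (Fin.last (a * b)) *ᵥ r)).re)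
    -- the certificate's F-V2 bond-charge labels (FORMAT-mpsgf1 §2 V1: transformed particle number `Ñ`)
    (Nt : ℕ) (c : Fin (a * b + 1) → Fin D → ℕ)
    (hcl : ∀ α, l α ≠ 0 → c 0 α = 0) (hcr : ∀ β, r β ≠ 0 → c (Fin.last (a * b)) β = Nt)
    (hcA : ∀ (j : Fin (a * b)) (s : Fin 4) (α β : Fin D),
      A j s α β ≠ 0 → c j.succ β = c j.castSucc α + siteCharge s)
    -- the zero-field energy rows of `ψ̃` (part 32's `quadraticWindow_of_reader` at `h = 0`, or derived)
    (h0lo : ((e0lo : ℝ) * ((a : ℝ) * b)) *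
        (star (toSpinVec.symm
            (fun k : TensorIndex (Fin a ×ₗ Fin b) 4 => mpsOpenVar (a * b) A l r (fun i => k (e i)))) ⬝ᵥ
          toSpinVec.symm
            (fun k : TensorIndex (Fin a ×ₗ Fin b) 4 => mpsOpenVar (a * b) A l r (fun i => k (e i)))).re ≤
      (star (toSpinVec.symm
          (fun k : TensorIndex (Fin a ×ₗ Fin b) 4 => mpsOpenVar (a * b) A l r (fun i => k (e i)))) ⬝ᵥ
        (((partialParticleHole (spinDownOrbitals : Finset (Orb (Fin a ×ₗ Fin b))) * orbitalPhase g)ᴴ *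
            dWaveSourceOpenBox a b U μ 0 *
            (partialParticleHole (spinDownOrbitals : Finset (Orb (Fin a ×ₗ Fin b))) * orbitalPhase g)) *ᵥ
          toSpinVec.symm
            (fun k : TensorIndex (Fin a ×ₗ Fin b) 4 => mpsOpenVar (a * b) A l r (fun i => k (e i))))).re)
    (h0hi : (star (toSpinVec.symm
          (fun k : TensorIndex (Fin a ×ₗ Fin b) 4 => mpsOpenVar (a * b) A l r (fun i => k (e i)))) ⬝ᵥ
        (((partialParticleHole (spinDownOrbitals : Finset (Orb (Fin a ×ₗ Fin b))) * orbitalPhase g)ᴴ *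
            dWaveSourceOpenBox a b U μ 0 *
            (partialParticleHole (spinDownOrbitals : Finset (Orb (Fin a ×ₗ Fin b))) * orbitalPhase g)) *ᵥ
          toSpinVec.symm
            (fun k : TensorIndex (Fin a ×ₗ Fin b) 4 => mpsOpenVar (a * b) A l r (fun i => k (e i))))).re ≤
      ((e0hi : ℝ) * ((a : ℝ) * b)) *
        (star (toSpinVec.symm
            (fun k : TensorIndex (Fin a ×ₗ Fin b) 4 => mpsOpenVar (a * b) A l r (fun i => k (e i)))) ⬝ᵥ
          toSpinVec.symm
            (fun k : TensorIndex (Fin a ×ₗ Fin b) 4 => mpsOpenVar (a * b) A l r (fun i => k (e i)))).re)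
    -- the `docc` rows of `ψ̃` (part 36's `doccWindow_of_reader`)
    (hdlo : ((dlo : ℝ) * ((a : ℝ) * b)) *
        (star (toSpinVec.symm
            (fun k : TensorIndex (Fin a ×ₗ Fin b) 4 => mpsOpenVar (a * b) A l r (fun i => k (e i)))) ⬝ᵥ
          toSpinVec.symm
            (fun k : TensorIndex (Fin a ×ₗ Fin b) 4 => mpsOpenVar (a * b) A l r (fun i => k (e i)))).re ≤
      (star (toSpinVec.symm
          (fun k : TensorIndex (Fin a ×ₗ Fin b) 4 => mpsOpenVar (a * b) A l r (fun i => k (e i)))) ⬝ᵥ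
        (((partialParticleHole (spinDownOrbitals : Finset (Orb (Fin a ×ₗ Fin b))) * orbitalPhase g)ᴴ *
            (∑ x : Fin a ×ₗ Fin b, numberOp x 0 * numberOp x 1) *
            (partialParticleHole (spinDownOrbitals : Finset (Orb (Fin a ×ₗ Fin b))) * orbitalPhase g)) *ᵥ
          toSpinVec.symm
            (fun k : TensorIndex (Fin a ×ₗ Fin b) 4 => mpsOpenVar (a * b) A l r (fun i => k (e i))))).re)
    (hdhi : (star (toSpinVec.symm
          (fun k : TensorIndex (Fin a ×ₗ Fin b) 4 => mpsOpenVar (a * b) A l r (fun i => k (e i)))) ⬝ᵥ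
        (((partialParticleHole (spinDownOrbitals : Finset (Orb (Fin a ×ₗ Fin b))) * orbitalPhase g)ᴴ *
            (∑ x : Fin a ×ₗ Fin b, numberOp x 0 * numberOp x 1) *
            (partialParticleHole (spinDownOrbitals : Finset (Orb (Fin a ×ₗ Fin b))) * orbitalPhase g)) *ᵥ
          toSpinVec.symm
            (fun k : TensorIndex (Fin a ×ₗ Fin b) 4 => mpsOpenVar (a * b) A l r (fun i => k (e i))))).re ≤
      ((dhi : ℝ) * ((a : ℝ) * b)) *
        (star (toSpinVec.symm
            (fun k : TensorIndex (Fin a ×ₗ Fin b) 4 => mpsOpenVar (a * b) A l r (fun i => k (e i)))) ⬝ᵥ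
          toSpinVec.symm
            (fun k : TensorIndex (Fin a ×ₗ Fin b) 4 => mpsOpenVar (a * b) A l r (fun i => k (e i)))).re)
    -- the `K₂` rows of `ψ̃` (part 36's `hoppingWindow_of_reader` at `G = rectBoxDiagGraph a b`, `t = 1`)
    (hklo : ((k2lo : ℝ) * ((a : ℝ) * b)) *
        (star (toSpinVec.symm
            (fun k : TensorIndex (Fin a ×ₗ Fin b) 4 => mpsOpenVar (a * b) A l r (fun i => k (e i)))) ⬝ᵥ
          toSpinVec.symm
            (fun k : TensorIndex (Fin a ×ₗ Fin b) 4 => mpsOpenVar (a * b) A l r (fun i => k (e i)))).re ≤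
      (star (toSpinVec.symm
          (fun k : TensorIndex (Fin a ×ₗ Fin b) 4 => mpsOpenVar (a * b) A l r (fun i => k (e i)))) ⬝ᵥ
        (((partialParticleHole (spinDownOrbitals : Finset (Orb (Fin a ×ₗ Fin b))) * orbitalPhase g)ᴴ *
            hamiltonian (rectBoxDiagGraph a b) 1 0 *
            (partialParticleHole (spinDownOrbitals : Finset (Orb (Fin a ×ₗ Fin b))) * orbitalPhase g)) *ᵥ
          toSpinVec.symm
            (fun k : TensorIndex (Fin a ×ₗ Fin b) 4 => mpsOpenVar (a * b) A l r (fun i => k (e i))))).re)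
    (hkhi : (star (toSpinVec.symm
          (fun k : TensorIndex (Fin a ×ₗ Fin b) 4 => mpsOpenVar (a * b) A l r (fun i => k (e i)))) ⬝ᵥ
        (((partialParticleHole (spinDownOrbitals : Finset (Orb (Fin a ×ₗ Fin b))) * orbitalPhase g)ᴴ *
            hamiltonian (rectBoxDiagGraph a b) 1 0 *
            (partialParticleHole (spinDownOrbitals : Finset (Orb (Fin a ×ₗ Fin b))) * orbitalPhase g)) *ᵥ
          toSpinVec.symm
            (fun k : TensorIndex (Fin a ×ₗ Fin b) 4 => mpsOpenVar (a * b) A l r (fun i => k (e i))))).re ≤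
      ((k2hi : ℝ) * ((a : ℝ) * b)) *
        (star (toSpinVec.symm
            (fun k : TensorIndex (Fin a ×ₗ Fin b) 4 => mpsOpenVar (a * b) A l r (fun i => k (e i)))) ⬝ᵥ
          toSpinVec.symm
            (fun k : TensorIndex (Fin a ×ₗ Fin b) 4 => mpsOpenVar (a * b) A l r (fun i => k (e i)))).re) :
    ∃ ψ : Fock (Orb (Fin a ×ₗ Fin b)), HasParity (Nt + a * b) ψ ∧ star ψ ⬝ᵥ ψ = 1 ∧
      (star ψ ⬝ᵥ (dWaveSourceOpenBox a b U μ h *ᵥ ψ)).re ≤ ((eQ : ℚ) : ℝ) * ((a : ℝ) * b) ∧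
      ((nlo : ℚ) : ℝ) * ((a : ℝ) * b) ≤ (star ψ ⬝ᵥ (totalNumber *ᵥ ψ)).re ∧
      (star ψ ⬝ᵥ (totalNumber *ᵥ ψ)).re ≤ ((nhi : ℚ) : ℝ) * ((a : ℝ) * b) ∧
      ((e0lo : ℚ) : ℝ) * ((a : ℝ) * b) ≤ (star ψ ⬝ᵥ (dWaveSourceOpenBox a b U μ 0 *ᵥ ψ)).re ∧
      (star ψ ⬝ᵥ (dWaveSourceOpenBox a b U μ 0 *ᵥ ψ)).re ≤ ((e0hi : ℚ) : ℝ) * ((a : ℝ) * b) ∧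
      ((dlo : ℚ) : ℝ) * ((a : ℝ) * b) ≤
        (star ψ ⬝ᵥ ((∑ x : Fin a ×ₗ Fin b, numberOp x 0 * numberOp x 1) *ᵥ ψ)).re ∧
      (star ψ ⬝ᵥ ((∑ x : Fin a ×ₗ Fin b, numberOp x 0 * numberOp x 1) *ᵥ ψ)).re ≤
        ((dhi : ℚ) : ℝ) * ((a : ℝ) * b) ∧
      ((k2lo : ℚ) : ℝ) * ((a : ℝ) * b) ≤ (star ψ ⬝ᵥ (hamiltonian (rectBoxDiagGraph a b) 1 0 *ᵥ ψ)).re ∧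
      (star ψ ⬝ᵥ (hamiltonian (rectBoxDiagGraph a b) 1 0 *ᵥ ψ)).re ≤ ((k2hi : ℚ) : ℝ) * ((a : ℝ) * b) := by
  have hg' : ∀ i, ‖g i‖ = 1 := fun i => by rcases hg i with h1 | h1 <;> simp [h1]
  -- the energy row (part 22, producers' frame)
  have hE := producersSourcedBox_sentence_of_reader U μ h hg e he A l r κ hκ0 hκ Mo hM0 hMrow hMcol YH ρH hρH radH
    hrH0 hrH YN ρN hρN radN hrN0 hrN ((eQ : ℝ) * ((a : ℝ) * b)) hElo hEhi
  -- the density window (part 23), moved into the producers' frame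
  have hDW := densityWindow_of_reader e A l r κ hκ0 hκ Mn hMn0 hMnrow hMncol YD ρD hρD radD hrD0 hrD YN ρN hρN radN
    hrN0 hrN ((nlo : ℝ) * ((a : ℝ) * b)) ((nhi : ℝ) * ((a : ℝ) * b)) hnlo1 hnlo2 hnhi1 hnhi2
  rw [← gaugedShiba'_conjTranspose_conj_totalNumber hg'] at hDW
  -- V1 and V3 (part 31)
  have hN := transformedWitness_sector_of_reader e A l r Nt c hcl hcr hcA
  have hpos := transformedWitness_pos_of_reader e A l r κ hκ0 hκ YN ρN hρN radN hrN0 hrN hn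
  exact sourcedBoxFourRowNode_of_gaugedShibaWitness' a b U μ h eQ nlo nhi e0lo e0hi dlo dhi k2lo k2hi hg' _ hN
    hpos hE hDW.1 hDW.2 h0lo h0hi hdlo hdhi hklo hkhi

end ObsNodes

end Summit.Ventures.CertifiedManyBodySolver.Upper.IntervalReader

end
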